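import Literature.Probability.LatticeModels.CornerPermutation
import Literature.Probability.LatticeModels.FKInterfacePairing
import Literature.Probability.Percolation.InterfaceWindingJump
import Literature.Probability.Percolation.InterfaceLoopDeterminism
import Literature.Probability.Percolation.FKLoopNestingGaussianLimit
import Literature.GroupTheory.CombinatorialGroupTheory.CommutatorLength
import HarnessLib

/-!
# The loop representation of the free random-cluster measure at the self-dual point

First input of the Baxter–Kelland–Wu correspondence (DKLM 2026, §3.2, identity (3.2), behind
their Cor. 10 = `dklm2026_corollary10`): on a finite piece `Λ` of `ℤ²` with free boundary
conditions, the random-cluster weight at the self-dual point `p_sd(q) = √q/(1+√q)` is, up to a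
constant, `√q` to the number of loops of the loop representation,

  `p^{|ξ|} (1-p)^{|E_Λ ∖ ξ|} q^{k(ξ)} = (1-p)^{|E_Λ|} · √q^{|Λ|} · √q^{ℓ_Λ(ξ)}`   (`p = p_sd(q)`),

because of **Euler's relation for the loop representation**

  `ℓ_Λ(ξ) + |Λ| = 2 k(ξ) + |ξ|`

(Baxter–Kelland–Wu 1976, §3; DKKMO arXiv:2012.11672v2, §1.2 (the loop representation of the
critical random-cluster model, "each loop receives a weight `√q`"); Grimmett 2006, §6.1 for the
Euler relation on boxes). Everything is PROVED; the file introduces no named fact.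

## The loops, combinatorially

The loops of a configuration `β ⊆ E(ℤ²)` are the cycles of Smirnov's turning rule read as the
permutation `cornerPerm β` of the coded corners `(v, k) : Site 2 × Fin 4`
(`Literature.Probability.LatticeModels.CornerPermutation`): a corner is a directed medial edge
with its primal vertex `v` on the left, and its successor follows the target edge if it is open
and crosses it (turning around `v`) if it is closed. For a configuration all of whose edges have
both endpoints in the finite set `Λ`, the finite set of corners `cornerSet Λ = Λ × Fin 4` is
invariant, and `ℓ_Λ` is the number of cycles of the restricted permutation `pieceCornerPerm Λ ξ`
(`loopCount`; the cycle count is the tree's `PairingGenus.ncl`). The cycles through corners over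
`Λ` are exactly the interface loops of the lifted configuration that meet `Λ` (the other
interface loops of the lift are the unit circuits around the isolated vertices off `Λ`).

## Proof of Euler's relation (induction on `ξ`)

* `ξ = ∅`: every cycle is the `4`-cycle around a vertex, `ℓ = |Λ| = k`.
* Opening the closed edge `e = xy` composes the permutation with the transposition of the two
  corners `p`, `p̂` arriving at `e` (`nextCorner_toggle`), so `ℓ` goes up by one if `p`, `p̂` lie
  on the same cycle and down by one otherwise (`PairingGenus.ncl_add_one_le_ncl_swap_mul`,
  `ncl_swap_mul_le` and the merging lemma `sameCycle_swap_mul_of_not_sameCycle` below), while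
  `k` stays if `x ↔ y` and drops by one otherwise (`clusterCount_insert`).
* **The discrete Jordan-curve input** (`sameCycle_cornerPartner_iff`): for a closed lattice edge
  `e = xy`, the two corners arriving at `e` lie on the same cycle **iff** `x` and `y` are joined
  by open edges. "Only if": consecutive corners of a cycle share their vertex or an open edge.
  "If": the cycle through `p` is an interface loop (`isInterfaceLoop_orbitLoop`), whose winding
  number jumps by one exactly across its own darts (`InterfaceWindingJump`); hence the winding
  number of the loop around a lattice point is constant along open edges
  (`wind_meshPoint_eq_of_mem`), so equal at `x` and `y`, whereas if `p̂` were off the cycle it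
  would be one less at `y` than at `x` (the cycle crosses `e` at `x` but not at `y`).

## Main statements

* `isInterfaceLoop_orbitLoop`, `mem_darts_orbitLoop_iff` — cycles of the turning rule are
  interface loops; dart membership is orbit membership.
* `sameCycle_cornerPartner_iff` — the Jordan-curve input above.
* `loopCount_add_card` — `ℓ_Λ(ξ) + |Λ| = 2 k(ξ) + |ξ|` for `ξ ⊆ E_Λ`.
* `rcWeight_rcSelfDualPoint`, `rcWeight_div_rcPartitionFunction_rcSelfDualPoint`,
  `rcFreeBoxMeasure_rcSelfDualPoint` — the free random-cluster measure of a finite piece (of the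
  box `Λ_n`) at `p_sd(q)` is the loop measure `√q^{ℓ(ξ)} / ∑ √q^{ℓ}`.

## References

* R. J. Baxter, S. B. Kelland, F. Y. Wu, *Equivalence of the Potts model or Whitney polynomial
  with an ice-type model*, J. Phys. A 9 (1976) 397–406, §3 (polygon decomposition of the medial
  graph, weight `q^{1/2}` per polygon via Euler's relation). [BaxterKellandWu1976]
* H. Duminil-Copin, K. K. Kozlowski, D. Krachun, I. Manolescu, M. Oulamara, arXiv:2012.11672v2,
  §1.2 (loop representation of the critical random-cluster model on `ℤ²`). [arXiv201211672v2]
* H. Duminil-Copin, K. K. Kozlowski, P. Lammers, I. Manolescu, arXiv:2603.06268 (2026), §3.2,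
  (3.2) (the BKW identity behind Cor. 10). [DuminilCopinKozlowskiLammersManolescu2026]
* G. Grimmett, *The Random-Cluster Model* (2006), §6.1 eq. (6.5) (Euler), (6.9) (`p_sd`).
  [Grimmett2006]
-/

noncomputable section

open Set Function SimpleGraph Finset

namespace Literature.Probability.Percolation

open LatticeModels RandomPlanarGeometry
open Literature.GroupTheory.CombinatorialGroupTheory

/-! ### Two permutation lemmas: merging cycles by a transposition -/

section Perm

variable {γ : Type*} [Fintype γ] [DecidableEq γ]

open Equiv Equiv.Perm

/-- **Merging**: if `a`, `b` lie in different cycles of `ρ`, they lie in the same cycle of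
`swap a b * ρ` (following `ρ` from `b` around its cycle, the last step is redirected to `a`).
[folklore] -/
theorem sameCycle_swap_mul_of_not_sameCycle {ρ : Perm γ} {a b : γ} (h : ¬ρ.SameCycle a b) :
    (swap a b * ρ).SameCycle a b := by
  classical
  -- a positive return time of `b`
  have hex : ∃ m : ℕ, 0 < m ∧ (ρ ^ m) b = b :=
    ⟨orderOf ρ, orderOf_pos ρ, by rw [pow_orderOf_eq_one, Perm.one_apply]⟩
  let m := Nat.find hex
  have hm : 0 < m ∧ (ρ ^ m) b = b := Nat.find_spec hex
  have hmin : ∀ i, 0 < i → i < m → (ρ ^ i) b ≠ b := fun i hi him heq =>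
    Nat.find_min hex him ⟨hi, heq⟩
  have hna : ∀ i : ℕ, (ρ ^ i) b ≠ a := fun i heq => h ⟨-(i : ℤ), by
    rw [zpow_neg, zpow_natCast, Perm.inv_eq_iff_eq]; exact heq.symm⟩
  -- before the return, `swap a b * ρ` follows `ρ`
  have hfollow : ∀ i, i ≤ m - 1 → ((swap a b * ρ) ^ i) b = (ρ ^ i) b := by
    intro i hi
    induction i with
    | zero => simp
    | succ i ih =>
      rw [pow_succ', Perm.mul_apply, ih (by omega), Perm.mul_apply, ← Perm.mul_apply ρ, ← pow_succ']
      exact swap_apply_of_ne_of_ne (hna _) (hmin _ (Nat.succ_pos _) (by omega))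
  have hlast : ((swap a b * ρ) ^ m) b = a := by
    have e : m = m - 1 + 1 := by omega
    rw [e, pow_succ', Perm.mul_apply, hfollow (m - 1) le_rfl, Perm.mul_apply, ← Perm.mul_apply ρ,
      ← pow_succ', ← e, hm.2, swap_apply_right]
  have hba : (swap a b * ρ).SameCycle b a := ⟨(m : ℤ), by rw [zpow_natCast, hlast]⟩
  exact hba.symm

/-- **Cycle count under a transposition, splitting case**: if `a ≠ b` lie in the same cycle of
`σ`, then `σ * swap a b` has exactly one more cycle. [folklore] -/
theorem ncl_mul_swap_of_sameCycle {σ : Perm γ} {a b : γ} (hne : a ≠ b) (h : σ.SameCycle a b) :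
    PairingGenus.ncl (σ * swap a b) = PairingGenus.ncl σ + 1 := by
  rw [mul_swap_eq_swap_mul]
  have h' : σ.SameCycle (σ a) (σ b) := by rwa [sameCycle_apply_left, sameCycle_apply_right]
  have hne' : σ a ≠ σ b := fun heq => hne (σ.injective heq)
  have h1 := PairingGenus.ncl_add_one_le_ncl_swap_mul hne' h'
  have h2 := PairingGenus.ncl_swap_mul_le σ (σ a) (σ b)
  omega

/-- **Cycle count under a transposition, merging case**: if `a`, `b` lie in different cycles of
`σ`, then `σ * swap a b` has exactly one cycle less. [folklore] -/
theorem ncl_mul_swap_of_not_sameCycle {σ : Perm γ} {a b : γ} (h : ¬σ.SameCycle a b) :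
    PairingGenus.ncl (σ * swap a b) + 1 = PairingGenus.ncl σ := by
  rw [mul_swap_eq_swap_mul]
  have h' : ¬σ.SameCycle (σ a) (σ b) := by rwa [sameCycle_apply_left, sameCycle_apply_right]
  have hne' : σ a ≠ σ b := fun heq => h' (heq ▸ Equiv.Perm.SameCycle.refl σ (σ a))
  have hm := sameCycle_swap_mul_of_not_sameCycle h'
  -- split `swap (σ a) (σ b) * σ` back into `σ`
  have h1 := PairingGenus.ncl_add_one_le_ncl_swap_mul hne' hm
  rw [swap_mul_self_mul] at h1
  have h2 := PairingGenus.ncl_le_ncl_swap_mul_add_one σ (σ a) (σ b)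
  omega

end Perm

/-! ### Orbits of the turning rule -/

section Orbit

variable {β : BondConfig (Site 2)} {p : Site 2 × Fin 4}

/-- Powers of the corner permutation are iterates of the successor map. [cite: Smirnov2001, §2] -/
theorem cornerPerm_pow_apply (β : BondConfig (Site 2)) (m : ℕ) (c : Site 2 × Fin 4) :
    (cornerPerm β ^ m) c = (nextCorner β)^[m] c := by
  rw [Equiv.Perm.coe_pow]; rfl

/-- **Consecutive corners of an orbit share their vertex or an open edge**: the vertex of the
`m`-th corner of the orbit of `p` is joined to the vertex of `p` by open edges.
[cite: Smirnov2001, §2] -/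
theorem reachable_iterate_nextCorner (β : BondConfig (Site 2)) (p : Site 2 × Fin 4) (m : ℕ) :
    (openGraph β).Reachable p.1 ((nextCorner β)^[m] p).1 := by
  classical
  induction m with
  | zero => exact Reachable.refl _
  | succ m ih =>
    rw [iterate_succ_apply']
    refine ih.trans ?_
    set c := (nextCorner β)^[m] p
    by_cases h : cTgt c ∈ β
    · rw [nextCorner_of_mem h]
      refine Adj.reachable ?_
      rw [openGraph_adj]
      exact ⟨h, fun heq => cornerUnit_ne_zero (c.2 + 1) (left_eq_add.1 heq)⟩
    · rw [nextCorner_of_not_mem h]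

/-- A corner whose orbit stays in a finite set is periodic (the turning rule is injective).
[cite: Smirnov2001, §2] -/
theorem mem_periodicPts_nextCorner_of_finite {S : Set (Site 2 × Fin 4)} (hS : S.Finite)
    (horb : ∀ m, (nextCorner β)^[m] p ∈ S) : p ∈ periodicPts (nextCorner β) := by
  obtain ⟨i, j, hij, h⟩ := hS.exists_lt_map_eq_of_forall_mem horb
  refine mk_mem_periodicPts (n := j - i) (by omega) ?_
  have hj : (nextCorner β)^[i] ((nextCorner β)^[j - i] p) = (nextCorner β)^[i] p := by
    rw [← iterate_add_apply, show i + (j - i) = j by omega, h]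
  exact nextCorner_injective.iterate i hj

/-- On a periodic orbit every position is one of the first `Q` (minimal period) positions.
[folklore] -/
theorem exists_iterate_lt_iff (hp : p ∈ periodicPts (nextCorner β)) {c : Site 2 × Fin 4} :
    (∃ m, (nextCorner β)^[m] p = c) ↔
      ∃ m, m < minimalPeriod (nextCorner β) p ∧ (nextCorner β)^[m] p = c := by
  constructor
  · rintro ⟨m, rfl⟩
    exact ⟨m % minimalPeriod (nextCorner β) p, Nat.mod_lt _ (minimalPeriod_pos_of_mem_periodicPts hp),
      iterate_mod_minimalPeriod_eq⟩
  · rintro ⟨m, -, hm⟩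
    exact ⟨m, hm⟩

/-- A periodic orbit is closed under the successor map in both directions. [cite: Smirnov2001, §2] -/
theorem exists_iterate_eq_nextCorner_iff (hp : p ∈ periodicPts (nextCorner β)) {c : Site 2 × Fin 4} :
    (∃ m, (nextCorner β)^[m] p = nextCorner β c) ↔ ∃ m, (nextCorner β)^[m] p = c := by
  constructor
  · rintro ⟨m, hm⟩
    rcases m with _ | m
    · -- `p = next c`: then `c` is the last corner of the period
      have hQ := minimalPeriod_pos_of_mem_periodicPts hp
      refine ⟨minimalPeriod (nextCorner β) p - 1, nextCorner_injective (β := β) ?_⟩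
      have h1 : (nextCorner β)^[minimalPeriod (nextCorner β) p - 1 + 1] p = p := by
        rw [Nat.sub_add_cancel hQ, iterate_minimalPeriod]
      rw [iterate_succ_apply'] at h1
      rw [h1]
      simpa using hm
    · exact ⟨m, nextCorner_injective (by rwa [← iterate_succ_apply' (nextCorner β)])⟩
  · rintro ⟨m, rfl⟩
    exact ⟨m + 1, iterate_succ_apply' _ _ _⟩

/-- **Orbit membership is `SameCycle`** for the corner permutation (periodic base corner).
[cite: Smirnov2001, §2] -/
theorem sameCycle_cornerPerm_iff (hp : p ∈ periodicPts (nextCorner β)) {c : Site 2 × Fin 4} :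
    (cornerPerm β).SameCycle p c ↔ ∃ m, (nextCorner β)^[m] p = c := by
  constructor
  · rintro ⟨i, hi⟩
    obtain ⟨n, rfl | rfl⟩ := Int.eq_nat_or_neg i
    · exact ⟨n, by rwa [zpow_natCast, cornerPerm_pow_apply] at hi⟩
    · -- negative power: `ρ^n c = p`; then `ρ^{n (Q-1)} p = c`
      rw [zpow_neg, zpow_natCast, Equiv.Perm.inv_eq_iff_eq, cornerPerm_pow_apply] at hi
      set Q := minimalPeriod (nextCorner β) p with hQdef
      have hQ : 0 < Q := minimalPeriod_pos_of_mem_periodicPts hp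
      have hnQ : n + n * (Q - 1) = n * Q := by
        rw [Nat.mul_sub_one, Nat.add_sub_cancel' (Nat.le_mul_of_pos_right n hQ)]
      refine ⟨n * (Q - 1), (nextCorner_injective (β := β)).iterate n ?_⟩
      rw [← hi, ← iterate_add_apply, hnQ]
      exact ((isPeriodicPt_minimalPeriod (nextCorner β) p).const_mul n).eq
  · rintro ⟨m, rfl⟩
    exact ⟨m, by rw [zpow_natCast, cornerPerm_pow_apply]⟩

/-! ### The loop of an orbit is an interface loop -/

/-- **The medial loop of the orbit of a periodic corner `p`**: the source edges of the corners
`p, ρ p, …, ρ^{Q-1} p` (`ρ = nextCorner β`, `Q` the minimal period), i.e. the cycle of the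
turning rule through `p` read as a closed medial circuit. [cite: Smirnov2001, §2] -/
def orbitLoop (β : BondConfig (Site 2)) (p : Site 2 × Fin 4) : List MedialVertex :=
  (List.range (minimalPeriod (nextCorner β) p)).map fun m ↦ cSrc ((nextCorner β)^[m] p)

/-- The length of the orbit loop is the minimal period. [folklore] -/
@[simp] theorem length_orbitLoop (β : BondConfig (Site 2)) (p : Site 2 × Fin 4) :
    (orbitLoop β p).length = minimalPeriod (nextCorner β) p := by
  simp [orbitLoop]

/-- Entries of the orbit loop. [folklore] -/
theorem getElem_orbitLoop {i : ℕ} (hi : i < (orbitLoop β p).length) :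
    (orbitLoop β p)[i] = cSrc ((nextCorner β)^[i] p) := by
  simp [orbitLoop]

/-- The cyclic dart list of the list of the first `Q` values of a `Q`-periodic sequence.
[folklore] -/
theorem zip_rotate_map_range {α : Type*} (P : ℕ → α) {Q : ℕ} (hper : P Q = P 0) :
    ((List.range Q).map P).zip (((List.range Q).map P).rotate 1) =
      (List.range Q).map fun m ↦ (P m, P (m + 1)) := by
  apply List.ext_getElem (by simp)
  intro i _ h2
  simp only [List.length_map, List.length_range] at h2
  simp only [List.getElem_zip, List.getElem_map, List.getElem_range, List.getElem_rotate,
    List.length_map, List.length_range, Prod.mk.injEq, true_and]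
  rcases Nat.lt_or_ge (i + 1) Q with h | h
  · rw [Nat.mod_eq_of_lt h]
  · rw [show i + 1 = Q by omega, Nat.mod_self, hper]

/-- **The darts of the orbit loop are the (source, target) pairs of the corners of the orbit.**
[cite: Smirnov2001, §2] -/
theorem zip_rotate_orbitLoop (β : BondConfig (Site 2)) (p : Site 2 × Fin 4) :
    (orbitLoop β p).zip ((orbitLoop β p).rotate 1) =
      (List.range (minimalPeriod (nextCorner β) p)).map
        fun m ↦ (cSrc ((nextCorner β)^[m] p), cTgt ((nextCorner β)^[m] p)) := by
  rw [orbitLoop, zip_rotate_map_range (fun m ↦ cSrc ((nextCorner β)^[m] p)) (by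
    simp only [iterate_minimalPeriod, iterate_zero_apply])]
  refine List.map_congr_left fun m _ ↦ ?_
  rw [iterate_succ_apply', cSrc_nextCorner]

/-- **Dart membership is orbit membership**: the dart of the corner `c` belongs to the orbit loop
of the periodic corner `p` iff `c` lies on the orbit of `p`. [cite: Smirnov2001, §2] -/
theorem mem_darts_orbitLoop_iff (hp : p ∈ periodicPts (nextCorner β)) {c : Site 2 × Fin 4} :
    (cSrc c, cTgt c) ∈ (orbitLoop β p).zip ((orbitLoop β p).rotate 1) ↔
      ∃ m, (nextCorner β)^[m] p = c := by
  rw [zip_rotate_orbitLoop, List.mem_map, exists_iterate_lt_iff hp]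
  constructor
  · rintro ⟨m, hm, h⟩
    rw [Prod.mk.injEq] at h
    exact ⟨m, List.mem_range.1 hm, eq_of_cSrc_eq_of_cTgt_eq h.1 h.2⟩
  · rintro ⟨m, hm, rfl⟩
    exact ⟨m, List.mem_range.2 hm, rfl⟩

/-- **One step of the turning rule is a medial turn**: the darts of `c` and of `nextCorner β c`
obey `IsMedialTurn β` (crossing the closed target edge around the common vertex, or following
the open one inside the common face). No hypothesis on `β`. [cite: Smirnov2001, §2] -/
theorem isMedialTurn_nextCorner (β : BondConfig (Site 2)) (c : Site 2 × Fin 4) :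
    IsMedialTurn β (cSrc c) (cTgt c) (cTgt (nextCorner β c)) := by
  classical
  refine ⟨c.1, cFace c, (nextCorner β c).1, cFace (nextCorner β c), isCorner_cFace c,
    cornerSource_cFace c, cornerTarget_cFace c, isCorner_cFace _, ?_, cornerTarget_cFace _, ?_⟩
  · rw [cornerSource_cFace, cSrc_nextCorner]
  · by_cases h : cTgt c ∈ β
    · exact Or.inr ⟨(cFace_nextCorner_of_mem h).symm, h⟩
    · refine Or.inl ⟨?_, (dualEdge_mem_dualConfig_iff_notMem (cTgt_mem_edgeSet c)).2 h⟩
      rw [nextCorner_of_not_mem h]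

/-- **The orbit loop of a periodic corner is an interface loop of `β`** (for every bond
configuration `β`): its darts are distinct (distinct corners within a minimal period) and
consecutive darts obey the turning rule. [cite: arXiv201211672v2, §1.2] -/
theorem isInterfaceLoop_orbitLoop (hp : p ∈ periodicPts (nextCorner β)) :
    IsInterfaceLoop β (orbitLoop β p) where
  ne_nil := by
    rw [ne_eq, ← List.length_eq_zero_iff, length_orbitLoop]
    exact (minimalPeriod_pos_of_mem_periodicPts hp).ne'
  nodup := by
    rw [zip_rotate_orbitLoop]
    refine List.Nodup.map_on ?_ List.nodup_range
    intro i hi j hj hij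
    rw [List.mem_range] at hi hj
    rw [Prod.mk.injEq] at hij
    exact (iterate_eq_iterate_iff_of_lt_minimalPeriod hi hj).1 (eq_of_cSrc_eq_of_cTgt_eq hij.1 hij.2)
  turn := by
    intro i hi
    have hQ := minimalPeriod_pos_of_mem_periodicPts hp
    rw [length_orbitLoop] at hi
    have e1 : (orbitLoop β p)[(i + 1) % (orbitLoop β p).length]'(Nat.mod_lt _ (by simpa using hQ)) =
        cTgt ((nextCorner β)^[i] p) := by
      rw [getElem_orbitLoop]; simp only [length_orbitLoop]
      rw [iterate_mod_minimalPeriod_eq, iterate_succ_apply', cSrc_nextCorner]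
    have e2 : (orbitLoop β p)[(i + 2) % (orbitLoop β p).length]'(Nat.mod_lt _ (by simpa using hQ)) =
        cTgt (nextCorner β ((nextCorner β)^[i] p)) := by
      rw [getElem_orbitLoop]; simp only [length_orbitLoop]
      rw [iterate_mod_minimalPeriod_eq, iterate_succ_apply', cSrc_nextCorner, iterate_succ_apply']
    rw [getElem_orbitLoop, e1, e2]
    exact isMedialTurn_nextCorner β _

/-! ### Winding numbers of the orbit loop: jumps across its darts, constancy along open edges -/

/-- **Jump across a dart of the orbit**: around the vertex of a corner `c` ON the orbit of `p` the
orbit loop winds once more than around the centre of the face of `c`.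
[cite: arXiv201211672v2, §1.1] -/
theorem wind_orbitLoop_vertex_of_mem (hp : p ∈ periodicPts (nextCorner β)) {c : Site 2 × Fin 4}
    (hc : ∃ m, (nextCorner β)^[m] p = c) :
    (loopCurve 1 0 (orbitLoop β p)).wind (meshPoint 1 c.1) =
      (loopCurve 1 0 (orbitLoop β p)).wind (faceCenter (cFace c)) + 1 := by
  have h := (isInterfaceLoop_orbitLoop hp).wind_meshPoint_eq_wind_faceCenter_add_one (isCorner_cFace c)
  rw [cornerSource_cFace, cornerTarget_cFace] at h
  exact h ((mem_darts_orbitLoop_iff hp).2 hc)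

/-- **No jump off the orbit**: around the vertex of a corner `c` OFF the orbit of `p` the orbit
loop winds as around the centre of the face of `c`. [cite: arXiv201211672v2, §1.1] -/
theorem wind_orbitLoop_vertex_of_not_mem (hp : p ∈ periodicPts (nextCorner β)) {c : Site 2 × Fin 4}
    (hc : ¬∃ m, (nextCorner β)^[m] p = c) :
    (loopCurve 1 0 (orbitLoop β p)).wind (meshPoint 1 c.1) =
      (loopCurve 1 0 (orbitLoop β p)).wind (faceCenter (cFace c)) := by
  have h := (isInterfaceLoop_orbitLoop hp).wind_meshPoint_eq_wind_faceCenter (isCorner_cFace c)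
  rw [cornerSource_cFace, cornerTarget_cFace] at h
  exact h (fun hm ↦ hc ((mem_darts_orbitLoop_iff hp).1 hm))

/-- **The winding number of an orbit loop is constant along open edges**: if the target edge
`e = {v, w}` of the corner `c = (v, k)` is open, the loop winds equally around `v` and `w`.
(The successor of `c` follows `e` to `w` inside the same face `F`; both corners are on the orbit
or both are off it, and in either case `wind v - wind c_F = wind w - wind c_F`.)
[cite: arXiv201211672v2, §1.1] -/
theorem wind_meshPoint_eq_of_mem (hp : p ∈ periodicPts (nextCorner β)) {c : Site 2 × Fin 4}
    (hc : cTgt c ∈ β) :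
    (loopCurve 1 0 (orbitLoop β p)).wind (meshPoint 1 c.1) =
      (loopCurve 1 0 (orbitLoop β p)).wind (meshPoint 1 (c.1 + cornerUnit (c.2 + 1))) := by
  have hnext : nextCorner β c = (c.1 + cornerUnit (c.2 + 1), c.2 + 3) := nextCorner_of_mem hc
  have hface : cFace (nextCorner β c) = cFace c := cFace_nextCorner_of_mem hc
  have hv : (nextCorner β c).1 = c.1 + cornerUnit (c.2 + 1) := by rw [hnext]
  by_cases hon : ∃ m, (nextCorner β)^[m] p = c
  · have hon' : ∃ m, (nextCorner β)^[m] p = nextCorner β c := (exists_iterate_eq_nextCorner_iff hp).2 hon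
    have j1 := wind_orbitLoop_vertex_of_mem hp hon
    have j2 := wind_orbitLoop_vertex_of_mem hp hon'
    rw [hface, hv] at j2
    omega
  · have hoff' : ¬∃ m, (nextCorner β)^[m] p = nextCorner β c :=
      fun h ↦ hon ((exists_iterate_eq_nextCorner_iff hp).1 h)
    have j1 := wind_orbitLoop_vertex_of_not_mem hp hon
    have j2 := wind_orbitLoop_vertex_of_not_mem hp hoff'
    rw [hface, hv] at j2
    omega

/-- **The winding number of an orbit loop is constant on open clusters** (of a lattice
configuration). [cite: arXiv201211672v2, §1.1] -/
theorem wind_meshPoint_eq_of_reachable (hβ : β ⊆ (zdGraph 2).edgeSet)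
    (hp : p ∈ periodicPts (nextCorner β)) {x y : Site 2} (h : (openGraph β).Reachable x y) :
    (loopCurve 1 0 (orbitLoop β p)).wind (meshPoint 1 x) =
      (loopCurve 1 0 (orbitLoop β p)).wind (meshPoint 1 y) := by
  obtain ⟨w⟩ := h
  induction w with
  | nil => rfl
  | @cons a b _ hadj _ ih =>
    refine Eq.trans ?_ ih
    rw [openGraph_adj] at hadj
    obtain ⟨k, rfl⟩ : ∃ k : Fin 4, b = a + cornerUnit k := by
      rcases (zdGraph_two_adj_iff_add a b).1 (by simpa using hβ hadj.1) with h | h | h | h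
      exacts [⟨0, h⟩, ⟨1, h⟩, ⟨2, h⟩, ⟨3, h⟩]
    -- the corner `(a, k + 3)` arrives at the open edge `{a, a + u_k}`
    have hc : cTgt (a, k + 3) ∈ β := by
      rw [cTgt]; simp only; rw [fin4_add_three_add_one]; exact hadj.1
    have := wind_meshPoint_eq_of_mem hp hc
    simpa only [fin4_add_three_add_one] using this

/-! ### The discrete Jordan-curve input: same cycle iff joined by open edges -/

/-- **Same cycle ⇒ joined**: if the partner corner of `p` lies on the cycle of `p`, the two
endpoints of their common target edge are joined by open edges. [cite: Smirnov2001, §2] -/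
theorem reachable_of_sameCycle_cornerPartner (hp : p ∈ periodicPts (nextCorner β))
    (h : (cornerPerm β).SameCycle p (cornerPartner p)) :
    (openGraph β).Reachable p.1 (cornerPartner p).1 := by
  obtain ⟨m, hm⟩ := (sameCycle_cornerPerm_iff hp).1 h
  rw [← hm]
  exact reachable_iterate_nextCorner β p m

/-- **Joined ⇒ same cycle** (the discrete Jordan curve theorem for cycles of the turning rule):
for a lattice configuration `β`, a periodic corner `p` whose target edge `e = {x, y}` is CLOSED,
if `x`, `y` are joined by open edges then the two corners arriving at `e` lie on the same cycle.
Otherwise the winding number of the orbit loop of `p` would be equal at `x` and `y` (constancy on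
clusters) and at the same time one less at `y` (the loop crosses `e` next to `x`: the successor
of `p` is the corner `(x, k+1)` in the face of the partner, which is off the loop).
[cite: arXiv201211672v2, §1.1–§1.2] -/
theorem sameCycle_cornerPartner_of_reachable (hβ : β ⊆ (zdGraph 2).edgeSet)
    (hp : p ∈ periodicPts (nextCorner β)) (he : cTgt p ∉ β)
    (hr : (openGraph β).Reachable p.1 (cornerPartner p).1) :
    (cornerPerm β).SameCycle p (cornerPartner p) := by
  by_contra hnot
  rw [sameCycle_cornerPerm_iff hp] at hnot
  -- the successor `(x, k+1)` of `p` is on the orbit, in the face of the partner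
  have hnext : nextCorner β p = (p.1, p.2 + 1) := nextCorner_of_not_mem he
  have hon : ∃ m, (nextCorner β)^[m] p = nextCorner β p := ⟨1, rfl⟩
  have hface : cFace (cornerPartner p) = cFace (nextCorner β p) := by
    rw [hnext, cornerPartner, cFace, cFace]
    simp only
    rw [← fin4_add_one_add_one, faceAt_add_unit_succ]
  have j1 := wind_orbitLoop_vertex_of_mem hp hon
  have j2 := wind_orbitLoop_vertex_of_not_mem hp hnot
  have j3 := wind_meshPoint_eq_of_reachable hβ hp hr
  rw [hnext] at j1
  rw [hface, hnext] at j2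
  simp only at j1
  omega

/-- **The two corners arriving at a closed lattice edge `e = {x, y}` lie on the same cycle of the
turning rule iff `x` and `y` are joined by open edges** (periodic base corner, lattice
configuration). This is the topological input of Euler's relation for the loop representation.
[cite: BaxterKellandWu1976, §3] -/
theorem sameCycle_cornerPartner_iff (hβ : β ⊆ (zdGraph 2).edgeSet)
    (hp : p ∈ periodicPts (nextCorner β)) (he : cTgt p ∉ β) :
    (cornerPerm β).SameCycle p (cornerPartner p) ↔ (openGraph β).Reachable p.1 (cornerPartner p).1 :=
  ⟨reachable_of_sameCycle_cornerPartner hp, sameCycle_cornerPartner_of_reachable hβ hp he⟩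

end Orbit

/-! ### Configurations of a finite piece `Λ ⊆ ℤ²`, lifted to `ℤ²` -/

section Piece

variable (Λ : Finset (Site 2))

/-- The corners over `Λ`: `Λ × Fin 4` (four directed medial edges with their primal vertex in `Λ`
on the left). [cite: BaxterKellandWu1976, §3] -/
def cornerSet : Finset (Site 2 × Fin 4) := Λ ×ˢ Finset.univ

variable {Λ}

/-- Membership in `cornerSet`. [folklore] -/
@[simp] theorem mem_cornerSet {c : Site 2 × Fin 4} : c ∈ cornerSet Λ ↔ c.1 ∈ Λ := by
  simp [cornerSet]

/-- `|cornerSet Λ| = 4 |Λ|`. [folklore] -/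
theorem card_cornerSet (Λ : Finset (Site 2)) : #(cornerSet Λ) = 4 * #Λ := by
  rw [cornerSet, Finset.card_product, Finset.card_univ, Fintype.card_fin, mul_comm]

variable (Λ)

/-- The configuration of `ℤ²` obtained from a configuration `ξ` of the piece (edges of `↥Λ`) by
forgetting the subtype: the tree's reading of "`e` is open in `ξ`" (`pieceCylinderEvent`,
`∃ e' ∈ ξ, Sym2.map Subtype.val e' = e`). [cite: Grimmett2006, §4.2 (configurations on E_Λ)] -/
def liftCfg (ξ : Finset (Sym2 ↥Λ)) : BondConfig (Site 2) :=
  Sym2.map Subtype.val '' (↑ξ : Set (Sym2 ↥Λ))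

variable {Λ} {ξ : Finset (Sym2 ↥Λ)}

/-- Membership in the lifted configuration. [folklore] -/
theorem mem_liftCfg_iff {e : Sym2 (Site 2)} :
    e ∈ liftCfg Λ ξ ↔ ∃ e' ∈ ξ, Sym2.map Subtype.val e' = e := by
  simp [liftCfg]

/-- An edge of the piece is open in the lift iff it is open. [folklore] -/
theorem map_mem_liftCfg_iff {e : Sym2 ↥Λ} : Sym2.map Subtype.val e ∈ liftCfg Λ ξ ↔ e ∈ ξ := by
  rw [mem_liftCfg_iff]
  constructor
  · rintro ⟨e', he', h⟩
    rwa [← Sym2.map.injective Subtype.val_injective h]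
  · exact fun h ↦ ⟨e, h, rfl⟩

/-- Endpoints of lifted edges lie in `Λ`. [folklore] -/
theorem mem_of_mem_liftCfg {e : Sym2 (Site 2)} (he : e ∈ liftCfg Λ ξ) {v : Site 2} (hv : v ∈ e) :
    v ∈ Λ := by
  obtain ⟨e', -, rfl⟩ := mem_liftCfg_iff.1 he
  obtain ⟨a, -, rfl⟩ := Sym2.mem_map.1 hv
  exact a.2

/-- The lift of a configuration of the piece graph consists of lattice edges. [folklore] -/
theorem liftCfg_subset_edgeSet (hξ : ξ ⊆ (finsetGraph (zdGraph 2) Λ).edgeFinset) :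
    liftCfg Λ ξ ⊆ (zdGraph 2).edgeSet := by
  intro e he
  obtain ⟨e', he', rfl⟩ := mem_liftCfg_iff.1 he
  have h := hξ he'
  induction e' using Sym2.ind with
  | h a b =>
    rw [mem_edgeFinset, mem_edgeSet] at h
    rw [Sym2.map_mk, mem_edgeSet]
    exact h

/-- The lift of the empty configuration. [folklore] -/
@[simp] theorem liftCfg_empty : liftCfg Λ (∅ : Finset (Sym2 ↥Λ)) = ∅ := by
  simp [liftCfg]

/-- The lift commutes with opening an edge. [folklore] -/
theorem liftCfg_insert (e : Sym2 ↥Λ) (ξ : Finset (Sym2 ↥Λ)) :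
    liftCfg Λ (insert e ξ) = insert (Sym2.map Subtype.val e) (liftCfg Λ ξ) := by
  rw [liftCfg, liftCfg, Finset.coe_insert, Set.image_insert_eq]

/-- **The corners over `Λ` are invariant under the turning rule of a lifted configuration**
(following an open edge keeps the vertex in `Λ`, crossing a closed one keeps the vertex).
[cite: BaxterKellandWu1976, §3] -/
theorem nextCorner_mem_cornerSet_iff (ξ : Finset (Sym2 ↥Λ)) (c : Site 2 × Fin 4) :
    nextCorner (liftCfg Λ ξ) c ∈ cornerSet Λ ↔ c ∈ cornerSet Λ := by
  classical
  rw [mem_cornerSet, mem_cornerSet]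
  by_cases h : cTgt c ∈ liftCfg Λ ξ
  · rw [nextCorner_of_mem h]
    have h1 : c.1 ∈ Λ := mem_of_mem_liftCfg h (Sym2.mem_mk_left _ _)
    have h2 : c.1 + cornerUnit (c.2 + 1) ∈ Λ := mem_of_mem_liftCfg h (Sym2.mem_mk_right _ _)
    simp only [h1, h2]
  · rw [nextCorner_of_not_mem h]

/-- Corners over `Λ` are periodic for the turning rule of a lifted configuration. [cite: Smirnov2001, §2] -/
theorem mem_periodicPts_of_mem_cornerSet (ξ : Finset (Sym2 ↥Λ)) {p : Site 2 × Fin 4}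
    (hp : p ∈ cornerSet Λ) : p ∈ periodicPts (nextCorner (liftCfg Λ ξ)) := by
  refine mem_periodicPts_nextCorner_of_finite (S := ↑(cornerSet Λ)) (Finset.finite_toSet _) ?_
  intro m
  induction m with
  | zero => exact hp
  | succ m ih => rw [iterate_succ_apply']; exact (nextCorner_mem_cornerSet_iff ξ _).2 ih

variable (Λ)

/-- **The turning rule of the piece**: the corner permutation of the lifted configuration,
restricted to the (invariant, finite) set of corners over `Λ`. [cite: BaxterKellandWu1976, §3] -/
def pieceCornerPerm (ξ : Finset (Sym2 ↥Λ)) : Equiv.Perm ↥(cornerSet Λ) :=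
  (cornerPerm (liftCfg Λ ξ)).subtypePerm (nextCorner_mem_cornerSet_iff ξ)

/-- **The number of loops `ℓ_Λ(ξ)`** of the configuration `ξ` of the piece `Λ` with free
boundary conditions: the number of cycles of the turning rule on the corners over `Λ` (every
medial edge over `Λ` lies on exactly one loop; the loops avoiding `Λ`, unit circuits around the
isolated vertices off `Λ`, are not counted). [cite: BaxterKellandWu1976, §3] -/
def loopCount (ξ : Finset (Sym2 ↥Λ)) : ℕ := PairingGenus.ncl (pieceCornerPerm Λ ξ)

variable {Λ}

/-- The piece permutation acts as the turning rule. [folklore] -/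
@[simp] theorem pieceCornerPerm_apply_val (ξ : Finset (Sym2 ↥Λ)) (c : ↥(cornerSet Λ)) :
    ((pieceCornerPerm Λ ξ c : ↥(cornerSet Λ)) : Site 2 × Fin 4) = nextCorner (liftCfg Λ ξ) c := rfl

/-- Cycles of the piece permutation are cycles of the corner permutation. [folklore] -/
theorem sameCycle_pieceCornerPerm_iff (ξ : Finset (Sym2 ↥Λ)) (a b : ↥(cornerSet Λ)) :
    (pieceCornerPerm Λ ξ).SameCycle a b ↔ (cornerPerm (liftCfg Λ ξ)).SameCycle a.1 b.1 :=
  Equiv.Perm.sameCycle_subtypePerm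

/-! ### Reachability in the piece and in the lift -/

/-- **Open paths of the piece and of its lift correspond.** [cite: Grimmett2006, §4.2] -/
theorem reachable_liftCfg_iff (ξ : Finset (Sym2 ↥Λ)) (u v : ↥Λ) :
    (openGraph (liftCfg Λ ξ)).Reachable u.1 v.1 ↔
      (openGraph (↑ξ : BondConfig ↥Λ)).Reachable u v := by
  constructor
  · -- pull a lattice walk back to the piece, vertex by vertex
    suffices h : ∀ (x y : Site 2) (w : (openGraph (liftCfg Λ ξ)).Walk x y) (hx : x ∈ Λ) (hy : y ∈ Λ),
        (openGraph (↑ξ : BondConfig ↥Λ)).Reachable ⟨x, hx⟩ ⟨y, hy⟩ by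
      rintro ⟨w⟩
      exact h _ _ w u.2 v.2
    intro x y w
    induction w with
    | nil => intro hx hy; exact Reachable.refl _
    | @cons a b _ hadj _ ih =>
      intro ha hy
      rw [openGraph_adj] at hadj
      have hb : b ∈ Λ := mem_of_mem_liftCfg hadj.1 (Sym2.mem_mk_right _ _)
      refine Reachable.trans (Adj.reachable ?_) (ih hb hy)
      rw [openGraph_adj]
      refine ⟨?_, fun h ↦ hadj.2 (congrArg Subtype.val h)⟩
      rw [Finset.mem_coe, ← map_mem_liftCfg_iff (Λ := Λ) (ξ := ξ), Sym2.map_mk]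
      exact hadj.1
  · rintro ⟨w⟩
    let φ : openGraph (↑ξ : BondConfig ↥Λ) →g openGraph (liftCfg Λ ξ) :=
      { toFun := Subtype.val
        map_rel' := fun {a b} h ↦ by
          rw [openGraph_adj] at h ⊢
          refine ⟨?_, Subtype.val_injective.ne h.2⟩
          show Sym2.map Subtype.val s(a, b) ∈ liftCfg Λ ξ
          rw [map_mem_liftCfg_iff]
          exact Finset.mem_coe.1 h.1 }
    exact ⟨w.map φ⟩

/-! ### Euler's relation for the loop representation -/

open Fin.NatCast in
/-- The `4`-cycles of the empty configuration: `ρ_∅^n (v, k) = (v, k + n)`. [folklore] -/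
theorem pieceCornerPerm_empty_pow_apply (c : ↥(cornerSet Λ)) (n : ℕ) :
    ((pieceCornerPerm Λ ∅ ^ n) c : Site 2 × Fin 4) = (c.1.1, c.1.2 + (n : Fin 4)) := by
  induction n with
  | zero => simp
  | succ n ih =>
    rw [pow_succ', Equiv.Perm.mul_apply, pieceCornerPerm_apply_val, ih, liftCfg_empty,
      nextCorner_of_not_mem (Set.notMem_empty _)]
    simp only [Nat.cast_succ, Prod.mk.injEq, true_and]
    abel

open Fin.NatCast in
/-- **Base case**: the empty configuration of the piece has `|Λ|` loops (one `4`-cycle per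
vertex). [cite: BaxterKellandWu1976, §3] -/
theorem loopCount_empty (Λ : Finset (Site 2)) : loopCount Λ ∅ = #Λ := by
  classical
  unfold loopCount PairingGenus.ncl
  -- every orbit is the orbit of a corner with face index `0`
  have h0 : ∀ c : ↥(cornerSet Λ), ∃ h : ((c : Site 2 × Fin 4).1, (0 : Fin 4)) ∈ cornerSet Λ,
      PairingGenus.cls (pieceCornerPerm Λ ∅) c =
        PairingGenus.cls (pieceCornerPerm Λ ∅) ⟨((c : Site 2 × Fin 4).1, 0), h⟩ := by
    intro c
    have h1 : (c : Site 2 × Fin 4).1 ∈ Λ := mem_cornerSet.1 c.2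
    refine ⟨mem_cornerSet.2 h1, PairingGenus.cls_eq_cls_iff.2 ?_⟩
    refine ⟨(((0 - (c : Site 2 × Fin 4).2 : Fin 4) : ℕ) : ℤ), Subtype.ext ?_⟩
    rw [zpow_natCast, pieceCornerPerm_empty_pow_apply, Fin.cast_val_eq_self]
    simp
  have himage : (Finset.univ.image (PairingGenus.cls (pieceCornerPerm Λ ∅))) =
      Λ.attach.image fun v ↦ PairingGenus.cls (pieceCornerPerm Λ ∅) ⟨(v.1, 0), mem_cornerSet.2 v.2⟩ := by
    ext C
    simp only [Finset.mem_image, Finset.mem_univ, true_and, Finset.mem_attach]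
    constructor
    · rintro ⟨c, rfl⟩
      obtain ⟨h, hc⟩ := h0 c
      exact ⟨⟨(c : Site 2 × Fin 4).1, mem_cornerSet.1 c.2⟩, hc.symm⟩
    · rintro ⟨v, rfl⟩
      exact ⟨_, rfl⟩
  rw [himage, Finset.card_image_of_injective, Finset.card_attach]
  intro v w hvw
  have hsc := PairingGenus.cls_eq_cls_iff.1 hvw
  obtain ⟨n, hn⟩ := hsc.exists_nat_pow_eq
  have h2 := congrArg (fun c : ↥(cornerSet Λ) ↦ (c : Site 2 × Fin 4).1) hn
  simp only [pieceCornerPerm_empty_pow_apply] at h2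
  exact Subtype.ext h2

/-- The number of clusters of the empty configuration of a finite vertex type is the number of
vertices. [cite: Grimmett2006, §1.2] -/
theorem clusterCount_coe_empty {V : Type*} [Fintype V] :
    clusterCount (↑(∅ : Finset (Sym2 V)) : BondConfig V) ∅ = Fintype.card V := by
  unfold clusterCount
  rw [Finset.coe_empty, wired_empty, sup_bot_eq, openGraph, fromEdgeSet_empty, ← Nat.card_eq_fintype_card]
  refine Nat.card_congr ⟨ConnectedComponent.lift id fun u v w _ ↦ ?_, (⊥ : SimpleGraph V).connectedComponentMk,
    ?_, fun v ↦ ConnectedComponent.lift_mk⟩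
  · cases w with
    | nil => rfl
    | cons h _ => exact ((bot_adj _ _).1 h).elim
  · intro C
    induction C using ConnectedComponent.ind with
    | h v => rfl

/-- **Opening an edge composes the turning rule of the piece with a transposition** of the two
corners arriving at it (`nextCorner_toggle` restricted to the corners over `Λ`).
[cite: Smirnov2010, proof of Lemma 4.5] -/
theorem pieceCornerPerm_insert {u v : ↥Λ} {k : Fin 4} (hk : v.1 = u.1 + cornerUnit k)
    (huv : s(u, v) ∉ ξ) (ha : (u.1, k + 3) ∈ cornerSet Λ) (hb : cornerPartner (u.1, k + 3) ∈ cornerSet Λ) :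
    pieceCornerPerm Λ (insert s(u, v) ξ) =
      pieceCornerPerm Λ ξ * Equiv.swap ⟨(u.1, k + 3), ha⟩ ⟨cornerPartner (u.1, k + 3), hb⟩ := by
  classical
  have htgt : cTgt (u.1, k + 3) = Sym2.map Subtype.val s(u, v) := by
    rw [cTgt, Sym2.map_mk, hk]
    simp only
    rw [fin4_add_three_add_one]
  have hnot : cTgt (u.1, k + 3) ∉ liftCfg Λ ξ := by rwa [htgt, map_mem_liftCfg_iff]
  refine Equiv.ext fun x ↦ Subtype.ext ?_
  rw [pieceCornerPerm_apply_val, liftCfg_insert, ← htgt, Equiv.Perm.mul_apply, pieceCornerPerm_apply_val,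
    Subtype.val_injective.map_swap]
  refine nextCorner_toggle (fun e hne ↦ ?_) ?_ x.1
  · simp [Set.mem_insert_iff, hne]
  · simp [hnot]

/-- An edge of the piece graph `G_Λ` is a unit step of `ℤ²`: `v = u + cornerUnit k`. [folklore] -/
theorem exists_cornerUnit_of_mem_edgeFinset {u v : ↥Λ}
    (h : s(u, v) ∈ (finsetGraph (zdGraph 2) Λ).edgeFinset) : ∃ k : Fin 4, v.1 = u.1 + cornerUnit k := by
  rw [mem_edgeFinset, mem_edgeSet] at h
  rcases (zdGraph_two_adj_iff_add u.1 v.1).1 h with h | h | h | h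
  exacts [⟨0, h⟩, ⟨1, h⟩, ⟨2, h⟩, ⟨3, h⟩]

/-- **Opening an edge, on the corners of the piece**: the new turning rule is the old one composed
with the transposition of two distinct corners, which lie on the same cycle iff the endpoints of
the edge were joined by open edges. [cite: BaxterKellandWu1976, §3] -/
theorem exists_pieceCornerPerm_insert (hξ : ξ ⊆ (finsetGraph (zdGraph 2) Λ).edgeFinset) {u v : ↥Λ}
    (he : s(u, v) ∈ (finsetGraph (zdGraph 2) Λ).edgeFinset) (huv : s(u, v) ∉ ξ) :
    ∃ a b : ↥(cornerSet Λ), a ≠ b ∧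
      pieceCornerPerm Λ (insert s(u, v) ξ) = pieceCornerPerm Λ ξ * Equiv.swap a b ∧
      ((pieceCornerPerm Λ ξ).SameCycle a b ↔ (openGraph (↑ξ : BondConfig ↥Λ)).Reachable u v) := by
  classical
  obtain ⟨k, hk⟩ := exists_cornerUnit_of_mem_edgeFinset he
  have hpv : (cornerPartner (u.1, k + 3)).1 = v.1 := by
    rw [cornerPartner, hk]
    simp only
    rw [fin4_add_three_add_one]
  have ha : ((u.1, k + 3) : Site 2 × Fin 4) ∈ cornerSet Λ := mem_cornerSet.2 u.2
  have hb : cornerPartner (u.1, k + 3) ∈ cornerSet Λ := mem_cornerSet.2 (by rw [hpv]; exact v.2)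
  have htgt : cTgt (u.1, k + 3) = Sym2.map Subtype.val s(u, v) := by
    rw [cTgt, Sym2.map_mk, hk]
    simp only
    rw [fin4_add_three_add_one]
  have hclosed : cTgt (u.1, k + 3) ∉ liftCfg Λ ξ := by rwa [htgt, map_mem_liftCfg_iff]
  refine ⟨⟨_, ha⟩, ⟨_, hb⟩, fun h ↦ partner_ne _ (congrArg Subtype.val h).symm,
    pieceCornerPerm_insert hk huv ha hb, ?_⟩
  rw [sameCycle_pieceCornerPerm_iff]
  change (cornerPerm (liftCfg Λ ξ)).SameCycle (u.1, k + 3) (cornerPartner (u.1, k + 3)) ↔ _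
  rw [sameCycle_cornerPartner_iff (liftCfg_subset_edgeSet hξ) (mem_periodicPts_of_mem_cornerSet ξ ha) hclosed]
  change (openGraph (liftCfg Λ ξ)).Reachable u.1 (cornerPartner (u.1, k + 3)).1 ↔ _
  rw [hpv, reachable_liftCfg_iff]

/-- **Loop count under opening an edge, joined case**: `ℓ` goes up by one.
[cite: BaxterKellandWu1976, §3] -/
theorem loopCount_insert_of_reachable (hξ : ξ ⊆ (finsetGraph (zdGraph 2) Λ).edgeFinset) {u v : ↥Λ}
    (he : s(u, v) ∈ (finsetGraph (zdGraph 2) Λ).edgeFinset) (huv : s(u, v) ∉ ξ)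
    (hR : (openGraph (↑ξ : BondConfig ↥Λ)).Reachable u v) :
    loopCount Λ (insert s(u, v) ξ) = loopCount Λ ξ + 1 := by
  classical
  obtain ⟨a, b, hne, hperm, key⟩ := exists_pieceCornerPerm_insert hξ he huv
  unfold loopCount
  rw [hperm]
  exact ncl_mul_swap_of_sameCycle hne (key.2 hR)

/-- **Loop count under opening an edge, disjoint case**: `ℓ` goes down by one.
[cite: BaxterKellandWu1976, §3] -/
theorem loopCount_insert_of_not_reachable (hξ : ξ ⊆ (finsetGraph (zdGraph 2) Λ).edgeFinset) {u v : ↥Λ}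
    (he : s(u, v) ∈ (finsetGraph (zdGraph 2) Λ).edgeFinset) (huv : s(u, v) ∉ ξ)
    (hR : ¬(openGraph (↑ξ : BondConfig ↥Λ)).Reachable u v) :
    loopCount Λ (insert s(u, v) ξ) + 1 = loopCount Λ ξ := by
  classical
  obtain ⟨a, b, -, hperm, key⟩ := exists_pieceCornerPerm_insert hξ he huv
  unfold loopCount
  rw [hperm]
  exact ncl_mul_swap_of_not_sameCycle (fun h ↦ hR (key.1 h))

/-- **Euler's relation for the loop representation** of a finite piece of `ℤ²` with free
boundary conditions: `ℓ_Λ(ξ) + |Λ| = 2 k(ξ) + |ξ|` for every `ξ ⊆ E_Λ`, where `k` counts all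
open clusters (isolated vertices included). [cite: BaxterKellandWu1976, §3] -/
theorem loopCount_add_card (hξ : ξ ⊆ (finsetGraph (zdGraph 2) Λ).edgeFinset) :
    loopCount Λ ξ + #Λ = 2 * clusterCount (↑ξ : BondConfig ↥Λ) ∅ + #ξ := by
  classical
  induction ξ using Finset.induction_on with
  | empty =>
    rw [loopCount_empty, clusterCount_coe_empty, Fintype.card_coe, Finset.card_empty]
    ring
  | @insert e ξ hne ih =>
    have hξ' : ξ ⊆ (finsetGraph (zdGraph 2) Λ).edgeFinset := (Finset.subset_insert _ _).trans hξ
    have he : e ∈ (finsetGraph (zdGraph 2) Λ).edgeFinset := hξ (Finset.mem_insert_self _ _)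
    specialize ih hξ'
    rw [Finset.card_insert_of_notMem hne]
    induction e using Sym2.ind with
    | h u v =>
      have hc := clusterCount_insert ξ u v (∅ : Set ↥Λ)
      simp only [wired_empty, sup_bot_eq] at hc
      by_cases hR : (openGraph (↑ξ : BondConfig ↥Λ)).Reachable u v
      · have hl := loopCount_insert_of_reachable hξ' he hne hR
        rw [if_pos hR] at hc
        omega
      · have hl := loopCount_insert_of_not_reachable hξ' he hne hR
        rw [if_neg hR] at hc
        omega

/-! ### The free random-cluster weight at the self-dual point is `√q` per loop -/

/-- `1 - p_sd(q) = 1/(1 + √q)`. [cite: Grimmett2006, (6.9)] -/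
theorem one_sub_rcSelfDualPoint (q : ℝ) : 1 - rcSelfDualPoint q = 1 / (1 + Real.sqrt q) := by
  have h : 0 < 1 + Real.sqrt q := by positivity
  rw [rcSelfDualPoint]
  field_simp
  ring

/-- `(1 - p_sd) √q = p_sd`. [cite: Grimmett2006, (6.9)] -/
theorem one_sub_rcSelfDualPoint_mul_sqrt (q : ℝ) :
    (1 - rcSelfDualPoint q) * Real.sqrt q = rcSelfDualPoint q := by
  rw [one_sub_rcSelfDualPoint, rcSelfDualPoint]
  ring

/-- **The free random-cluster weight at the self-dual point is `√q` to the number of loops**: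
for `ξ ⊆ E_Λ` and `q > 0`,
`p^{|ξ|} (1-p)^{|E_Λ ∖ ξ|} q^{k(ξ)} = (1-p)^{|E_Λ|} √q^{|Λ|} √q^{ℓ_Λ(ξ)}` at `p = p_sd(q)`.
[cite: BaxterKellandWu1976, §3] -/
theorem rcWeight_rcSelfDualPoint {q : ℝ} (hq : 0 < q) (hξ : ξ ⊆ (finsetGraph (zdGraph 2) Λ).edgeFinset) :
    rcWeight (finsetGraph (zdGraph 2) Λ) (rcSelfDualPoint q) q ∅ ξ =
      (1 - rcSelfDualPoint q) ^ #(finsetGraph (zdGraph 2) Λ).edgeFinset *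
        Real.sqrt q ^ #Λ * Real.sqrt q ^ loopCount Λ ξ := by
  classical
  have haE : #ξ ≤ #(finsetGraph (zdGraph 2) Λ).edgeFinset := Finset.card_le_card hξ
  have hsq : Real.sqrt q ^ 2 = q := Real.sq_sqrt hq.le
  have heuler : loopCount Λ ξ + #Λ = 2 * clusterCount (↑ξ : BondConfig ↥Λ) ∅ + #ξ :=
    loopCount_add_card hξ
  have hpow : Real.sqrt q ^ #Λ * Real.sqrt q ^ loopCount Λ ξ =
      q ^ clusterCount (↑ξ : BondConfig ↥Λ) ∅ * Real.sqrt q ^ #ξ := by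
    rw [← pow_add, add_comm, heuler, pow_add, pow_mul, hsq]
  obtain ⟨d, hd⟩ := Nat.exists_eq_add_of_le haE
  unfold rcWeight
  rw [Finset.card_sdiff_of_subset hξ, mul_assoc ((1 - rcSelfDualPoint q) ^ _), hpow, hd,
    Nat.add_sub_cancel_left]
  calc rcSelfDualPoint q ^ #ξ * (1 - rcSelfDualPoint q) ^ d * q ^ clusterCount (↑ξ : BondConfig ↥Λ) ∅
      = ((1 - rcSelfDualPoint q) * Real.sqrt q) ^ #ξ * (1 - rcSelfDualPoint q) ^ d *
          q ^ clusterCount (↑ξ : BondConfig ↥Λ) ∅ := by rw [one_sub_rcSelfDualPoint_mul_sqrt]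
    _ = (1 - rcSelfDualPoint q) ^ (#ξ + d) *
          (q ^ clusterCount (↑ξ : BondConfig ↥Λ) ∅ * Real.sqrt q ^ #ξ) := by
        rw [mul_pow, pow_add]; ring

/-- The constant `(1-p)^{|E|} √q^{|Λ|}` is positive. [folklore] -/
theorem rcSelfDual_const_pos {q : ℝ} (hq : 0 < q) (Λ : Finset (Site 2)) :
    0 < (1 - rcSelfDualPoint q) ^ #(finsetGraph (zdGraph 2) Λ).edgeFinset * Real.sqrt q ^ #Λ := by
  have h1 : 0 < 1 - rcSelfDualPoint q := by rw [one_sub_rcSelfDualPoint]; positivity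
  have h2 : 0 < Real.sqrt q := Real.sqrt_pos.2 hq
  positivity

/-- **The free random-cluster measure at the self-dual point is the loop measure**: the
probability of `ξ ⊆ E_Λ` is `√q^{ℓ_Λ(ξ)} / ∑_{ξ'} √q^{ℓ_Λ(ξ')}`. [cite: arXiv201211672v2, §1.2] -/
theorem rcWeight_div_rcPartitionFunction_rcSelfDualPoint {q : ℝ} (hq : 0 < q)
    (hξ : ξ ⊆ (finsetGraph (zdGraph 2) Λ).edgeFinset) :
    rcWeight (finsetGraph (zdGraph 2) Λ) (rcSelfDualPoint q) q ∅ ξ /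
        rcPartitionFunction (finsetGraph (zdGraph 2) Λ) (rcSelfDualPoint q) q ∅ =
      Real.sqrt q ^ loopCount Λ ξ /
        ∑ ξ' ∈ (finsetGraph (zdGraph 2) Λ).edgeFinset.powerset, Real.sqrt q ^ loopCount Λ ξ' := by
  rw [rcPartitionFunction, rcWeight_rcSelfDualPoint hq hξ, Finset.sum_congr rfl
    (fun ξ' hξ' ↦ rcWeight_rcSelfDualPoint hq (Finset.mem_powerset.1 hξ')), ← Finset.mul_sum,
    mul_div_mul_left _ _ (rcSelfDual_const_pos hq Λ).ne']

/-- **The free random-cluster measure of the box `Λ_n` at the self-dual point, as the loop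
measure**: `φ⁰_{Λ_n,p_sd(q),q} = ∑_{ξ ⊆ E_{Λ_n}} (√q^{ℓ(ξ)} / ∑ √q^{ℓ}) δ_ξ` — the form in
which it enters the Baxter–Kelland–Wu correspondence. [cite: DuminilCopinKozlowskiLammersManolescu2026, §3.2] -/
theorem rcFreeBoxMeasure_rcSelfDualPoint {q : ℝ} (hq : 0 < q) (n : ℕ) :
    rcFreeBoxMeasure (rcSelfDualPoint q) q n =
      ∑ ξ ∈ (finsetGraph (zdGraph 2) (box 2 n)).edgeFinset.powerset,
        ENNReal.ofReal (Real.sqrt q ^ loopCount (box 2 n) ξ /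
          ∑ ξ' ∈ (finsetGraph (zdGraph 2) (box 2 n)).edgeFinset.powerset,
            Real.sqrt q ^ loopCount (box 2 n) ξ') •
          MeasureTheory.Measure.dirac (↑ξ : BondConfig ↥(box 2 n)) := by
  rw [rcFreeBoxMeasure, rcMeasure]
  refine Finset.sum_congr rfl fun ξ hξ ↦ ?_
  rw [rcWeight_div_rcPartitionFunction_rcSelfDualPoint hq (Finset.mem_powerset.1 hξ)]

end Piece

end Literature.Probability.Percolation

end
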